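import Summits.AtomisticToContinuum.FouriersLaw.Theorems.BondHeatUncertaintyLightConeBondHeatStatics
import Summits.AtomisticToContinuum.FouriersLaw.Theorems.BondHeatUncertaintyLightConeBondHeatBondCorrelation

/-!
# `LightConeBondHeat` on `N`-independent windows

Support file for item `stmt-AtomisticToContinuum-9123` (`BondHeatUncertainty.LightConeBondHeat`, (S_lc)):
`∃ A a > 0, N₀ ∀ N ≥ N₀ ∃ b (b+1 < N) ∀ t ∈ [1, a·N], V_N(b,t) ≤ A√t` for the equilibrium bond-heat variance of the
pinned anharmonic chain.  Here the same conclusion is PROVED with the light-cone window `[1, a·N]` replaced by an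
arbitrary `N`-INDEPENDENT window `[1, t₀]` (`lightConeBondHeat_boundedWindow`, `N₀ = 2`, explicit `A`): the
`N`-uniform statics of `…LightConeBondHeatStatics` (a bond with `⟨j_b²⟩_T ≤ 4T² + 768β²T³/(lam ω₂)` for every
`N ≥ 2`) and the size bound `V_N(b,t) ≤ 2⟨j_b²⟩_T t²` of `…LightConeBondHeatBondCorrelation`.  What remains of
(S_lc) is therefore exactly the GROWTH of the window with `N` — the `N`-uniform `√t` (Edwards–Wilkinson) law of the
single-bond heat, i.e. dynamical cancellation in `C_N(b,·)`, an open problem for deterministic anharmonic chains.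
-/

noncomputable section

open MeasureTheory

namespace Summit.AtomisticToContinuum.FouriersLaw.Theorems.LightConeBondHeat

open Literature.MathematicalPhysics.KineticTheory.HeatConduction

/-- **(S_lc) on bounded windows, with an `N`-uniform constant.**  For the pinned anharmonic chain (all parameters
`> 0`), `T > 0` and every window length `t₀`: every chain of length `N ≥ 2` has a bond `b` (`b + 1 < N`) with
`V_N(b,t) ≤ A√t` for all `1 ≤ t ≤ t₀`, where `A = 2(4T² + 768β²T³/(lam ω₂))·t₀√t₀` does not depend on `N`
(`C`, `V` verbatim as in the route items (S) `SubdiffusiveBondHeat` / (S_lc) `LightConeBondHeat`).  Thus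
`LightConeBondHeat` holds with its window `a·N` replaced by any `N`-independent `t₀`; its open content is the
growth of the window with `N`. [folklore] -/
theorem lightConeBondHeat_boundedWindow :
    ∀ ω₂ lam β γ : ℝ, 0 < ω₂ → 0 < lam → 0 < β → 0 < γ → ∀ T : ℝ, 0 < T → ∀ t₀ : ℝ,
      (let P := pinnedChain ω₂ lam β γ
       let C : ℕ → ℕ → ℝ → ℝ := fun N b s => if h : b < N then ∫ z, P.bondCurrent N ⟨b, h⟩ z *
         (∫ y, P.bondCurrent N ⟨b, h⟩ y ∂(P.transitionKernel N T T s.toNNReal z)) ∂(P.gibbsMeasure N T) else 0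
       let V : ℕ → ℕ → ℝ → ℝ := fun N b t => 2 * ∫ s in (0 : ℝ)..t, (t - s) * C N b s
       ∀ N : ℕ, 2 ≤ N → ∃ b : ℕ, b + 1 < N ∧ ∀ t : ℝ, 1 ≤ t → t ≤ t₀ →
         V N b t ≤ (2 * (4 * T ^ 2 + 768 * β ^ 2 * T ^ 3 / (lam * ω₂)) * (t₀ * Real.sqrt t₀)) * Real.sqrt t) := by
  intro ω₂ lam β γ hω hl hβ hγ T hT t₀ P C V N hN
  obtain ⟨i, hi, hle⟩ := pinnedChain_exists_bond_sq_bondCurrent_le hω hl hβ γ hN hT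
  refine ⟨i.val, hi, fun t h1 ht₀ => ?_⟩
  have hpos : 0 < N := by omega
  have key := pinnedChain_bondHeatVar_le_sqrt_of_le hω hl.le hβ hγ hpos hT i.val i.isLt (t₀ := t₀) h1 ht₀
  have hle' : ∫ z, ((pinnedChain ω₂ lam β γ).bondCurrent N ⟨i.val, i.isLt⟩ z) ^ 2
      ∂((pinnedChain ω₂ lam β γ).gibbsMeasure N T) ≤ 4 * T ^ 2 + 768 * β ^ 2 * T ^ 3 / (lam * ω₂) := by
    simpa using hle
  have ht₀0 : 0 ≤ t₀ := by linarith
  have hw : 0 ≤ t₀ * Real.sqrt t₀ := mul_nonneg ht₀0 (Real.sqrt_nonneg _)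
  refine key.trans ?_
  apply mul_le_mul_of_nonneg_right _ (Real.sqrt_nonneg _)
  apply mul_le_mul_of_nonneg_right _ hw
  linarith

end Summit.AtomisticToContinuum.FouriersLaw.Theorems.LightConeBondHeat

end
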